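import Summits.BirchSwinnertonDyer.BirchSwinnertonDyer.Theses.InertBadSignedBranches
import Summits.BirchSwinnertonDyer.BirchSwinnertonDyer.Theorems.InertBadSignedBranchesPlusMCEtaKUpToMu
import HarnessLib

/-!
# Route `InertBadSignedBranches` (rung K8): CLOSER of the split child `PlusMCEtaKUpToMu` of item 19501

HONEST FRAMING (cell bsd-cm): BSD is NOT proved by any of this; a closed item closes a rung-internal
statement, never the summit. This file closes the SUPPORT child `PlusMCEtaKUpToMu` of the by-name split
of the residual crux 19501 `PlusMCEtaK` (planner bsd-cm-plan g20): item 19501 WITH THE `μ`-PART REMOVED,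
under the two Literature named facts it displays (`h26` = Burungale–Tian 2026 Thm. 2.6 ∘ Kobayashi 2003,
composed citation; `h22` = Kobayashi 2003 Thm. 2.2 at `η`), by ONE application of the landed helper
`Theorems.PlusMCEtaKUpToMu.plusMCEtaK_upToP_of_burungaleTian` (p473177, k8i-c42 g9 / k8i-ty g6).
Books nothing as known (the facts stay hypotheses of the item); moves no label; no `sorry`.
References: [BurungaleTian2026] Thm. 2.6, Rem. 2.7 (p. 5); [Kobayashi2003] Thm. 2.2 (p. 5), §5, Prop. 7.1 ii), Thm. 7.4.
-/

namespace Summit.BirchSwinnertonDyer.BirchSwinnertonDyer.Theorems.PlusMCEtaKUpToMuCloser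

open Summit.BirchSwinnertonDyer.BirchSwinnertonDyer.Theses.InertBadSignedBranches

/-- **Split child `PlusMCEtaKUpToMu` of item 19501 holds** (one line over p473177).
[cite: BurungaleTian2026, Thm. 2.6 (p. 5)] [cite: Kobayashi2003, Thm. 2.2 (p. 5), proof of Thm. 7.4 (p. 13)] -/
theorem plusMCEtaKUpToMu : PlusMCEtaKUpToMu := by
  intro h26 h22 p _ hp K₀ _ _ _ _ η hη hη1 V _ _ N _ f hCM hgood hap hf ϖ hϖ κ γ hκ hγ hγK hvar Lp hLp D
  exact Theorems.PlusMCEtaKUpToMu.plusMCEtaK_upToP_of_burungaleTian h26 h22 p hp K₀ η hη hη1 V hCM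
    hgood hap hf ϖ hϖ κ γ hκ hγ hγK hvar Lp hLp D

end Summit.BirchSwinnertonDyer.BirchSwinnertonDyer.Theorems.PlusMCEtaKUpToMuCloser
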